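import Literature.Computability.AlgebraicComplexity.ABV17SingPermThreeCodim
import HarnessLib

/-!
# Alper–Bogart–Velasco 2017, §1: `codim Sing(perm_4) ≥ 7` — preliminaries

Topic `Literature/Computability/AlgebraicComplexity`; first of three files typing the clause
"`codim(Sing(perm_4)) = 8`" of Alper–Bogart–Velasco 2017, §1 (arXiv:1505.02205 text p0003 L38:
"Since it can be readily computed that `codim(Sing(perm_3)) = 6` and `codim(Sing(perm_4)) = 8` …"),
in the tree's height currency (`codim Sing(f) = (singIdeal f).height`, `ABV17SingularLocusBound`),
as the LOWER BOUND `7 ≤ ht (per₄, ∂per₄/∂x_ij)` (the printed value `8` is a Macaulay2 computation;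
`≤ 8` is the tree's `alperBogartVelasco2017_rem_1_5`; the last unit `8 ≤` is NOT typed).  The
companion of `ABV17SingPermThreeCodim.lean` (`codim Sing(perm_3) = 6`), same method: generic point of
a prime + explicit chains of kernels (`VonZurGathenSingPermHeight.lean`), no dimension theory and no
computer algebra.

This file: generic tools.
* `height_ker_aeval_comp_equiv` — kernel heights are invariant under re-indexing the coordinates
  (both directions of the tree's `height_ker_aeval_comp_le`);
* `height_ker_aeval_piecewise_union_add_card_le` — vanishing coordinates can be freed AFTER an
  arbitrary set `T` of already freed coordinates (the tree's
  `height_ker_aeval_piecewise_add_card_le` is the case `T = ∅`);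
* `rsubperm_triple` — the six-term expansion of a `3 × 3` subpermanent;

Honest framing: dictionary work on von zur Gathen's problem (singular locus of the permanental
hypersurface); consumed by the (4,2) strength rung of Summits line `laplace_rigidity`
(`str₂(per₄) ≥ 4`); VP ≠ VNP is NOT proved and no rung of any route is moved by this file.

## References
* J. Alper, T. Bogart, M. Velasco, *A lower bound for the determinantal complexity of a
  hypersurface*, Found. Comput. Math. 17 (2017) 829–836, arXiv:1505.02205, §1 (p0003 L38).
  [AlperBogartVelasco2017]
* A. Boralevi, E. Carlini, M. Michałek, E. Ventura, *On the codimension of permanental varieties*,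
  Adv. Math. 461 (2025), arXiv:2402.17839, Thm. 4.14. [BoraleviCarliniMichalekVentura2025]
-/

noncomputable section

open Matrix MvPolynomial Finset

namespace Literature.Computability.AlgebraicComplexity

open VonZurGathen BoraleviCarliniMichalekVentura2025

namespace AlperBogartVelasco

/-! ### Re-indexing and late freeing of vanishing coordinates -/

section Generic

variable {K : Type*} [Field K] {L : Type*} [CommRing L] [IsDomain L] [Algebra K L]

/-- Kernel heights of evaluation maps are invariant under re-indexing the coordinates by an
equivalence (e.g. permuting rows and columns, transposing) — both directions of the restriction
inequality used for BCMV's generic points. [cite: BoraleviCarliniMichalekVentura2025, proof of Prop. 3.1 (arXiv text p0006 L9–17)] -/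
theorem height_ker_aeval_comp_equiv {σ σ' : Type*} [Finite σ] [Finite σ'] (e : σ ≃ σ')
    (a : σ' → L) :
    (RingHom.ker (aeval (R := K) (a ∘ e))).height = (RingHom.ker (aeval (R := K) a)).height := by
  refine le_antisymm (height_ker_aeval_comp_le (K := K) e.toEmbedding a) ?_
  have h := height_ker_aeval_comp_le (K := K) e.symm.toEmbedding (a ∘ e)
  have hcomp : (a ∘ e) ∘ e.symm.toEmbedding = a := by
    funext x
    simp
  rwa [hcomp] at h

variable {σ : Type*} [DecidableEq σ]

/-- **Late freeing of vanishing coordinates**: if `a` vanishes on `S` and `S` is disjoint from the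
already freed set `T`, then `height Q_{T ∪ S} + |S| ≤ height Q_T` (free the coordinates of `S` one
at a time with witness `X_x`; the tree's `height_ker_aeval_piecewise_add_card_le` is `T = ∅`);
the chain device of von zur Gathen's proof of Lemma 2.3. [cite: Vonzurgathen1987, proof of Lemma 2.3] -/
theorem height_ker_aeval_piecewise_union_add_card_le (a : σ → L) (T S : Finset σ)
    (hS : ∀ x ∈ S, a x = 0) (hdisj : Disjoint S T) :
    (RingHom.ker (aeval (R := K) ((T ∪ S).piecewise X (C ∘ a) : σ → MvPolynomial σ L))).height +
        S.card ≤
      (RingHom.ker (aeval (R := K) (T.piecewise X (C ∘ a) : σ → MvPolynomial σ L))).height := by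
  induction S using Finset.induction_on with
  | empty =>
    have h : ((T ∪ ∅).piecewise X (C ∘ a) : σ → MvPolynomial σ L) = T.piecewise X (C ∘ a) := by
      funext x; simp [Finset.piecewise]
    simp [h]
  | insert x S hx ih =>
    have hxT : x ∉ T := Finset.disjoint_left.1 hdisj (Finset.mem_insert_self x S)
    have hxTS : x ∉ T ∪ S := by
      rw [Finset.mem_union, not_or]; exact ⟨hxT, hx⟩
    have hstep := height_ker_aeval_piecewise_insert (K := K) a (T ∪ S) x (X x)
      (by rw [aeval_X, Finset.piecewise_eq_of_notMem (hi := hxTS), Function.comp_apply,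
        hS x (Finset.mem_insert_self _ _), map_zero])
      (by rw [aeval_X, Finset.piecewise_eq_of_mem (hi := Finset.mem_insert_self x (T ∪ S))]
          exact X_ne_zero _)
    have ih' := ih (fun y hy => hS y (Finset.mem_insert_of_mem hy))
      (Finset.disjoint_of_subset_left (Finset.subset_insert x S) hdisj)
    have hun : T ∪ insert x S = insert x (T ∪ S) := by
      rw [Finset.union_insert]
    rw [hun, Finset.card_insert_of_notMem hx, Nat.cast_succ, add_comm (S.card : ℕ∞) 1, ← add_assoc]
    exact (add_le_add hstep le_rfl).trans ih'

end Generic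

/-! ### The six-term expansion of a `3 × 3` subpermanent -/

section Triple

variable {R : Type*} [CommRing R] {ρ κ : Type*} [Fintype ρ] [Fintype κ] [DecidableEq ρ]
  [DecidableEq κ]

/-- A `3 × 3` subpermanent, expanded along its first row:
`per[{r₀,r₁,r₂} | {i,j,k}] = M r₀ i (M r₁ j M r₂ k + M r₁ k M r₂ j) + M r₀ j (…) + M r₀ k (…)`.
[cite: BurgisserClausenShokrollahi1997, (21.30)] -/
theorem rsubperm_triple (M : Matrix ρ κ R) {r₀ r₁ r₂ : ρ} {i j k : κ} (h₀₁ : r₀ ≠ r₁)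
    (h₀₂ : r₀ ≠ r₂) (h₁₂ : r₁ ≠ r₂) (hij : i ≠ j) (hik : i ≠ k) (hjk : j ≠ k) :
    rsubperm M (· ∈ ({i, j, k} : Finset κ)) (· ∈ ({r₀, r₁, r₂} : Finset ρ)) =
      M r₀ i * (M r₁ j * M r₂ k + M r₁ k * M r₂ j) +
        M r₀ j * (M r₁ i * M r₂ k + M r₁ k * M r₂ i) +
        M r₀ k * (M r₁ i * M r₂ j + M r₁ j * M r₂ i) := by
  have hr₀ : r₀ ∉ ({r₁, r₂} : Finset ρ) := by simp [h₀₁, h₀₂]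
  rw [show ({r₀, r₁, r₂} : Finset ρ) = insert r₀ {r₁, r₂} from rfl, rsubperm_insert_row M hr₀,
    Finset.sum_insert (by simp [hij, hik]), Finset.sum_pair hjk]
  have e1 : ({i, j, k} : Finset κ).erase i = {j, k} := by
    rw [Finset.erase_insert (by simp [hij, hik])]
  have e2 : ({i, j, k} : Finset κ).erase j = {i, k} := by
    ext x; simp only [Finset.mem_erase, Finset.mem_insert, Finset.mem_singleton]
    constructor
    · rintro ⟨hx, h | h | h⟩
      · exact Or.inl h
      · exact absurd h hx
      · exact Or.inr h
    · rintro (h | h)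
      · exact ⟨h ▸ hij, Or.inl h⟩
      · exact ⟨h ▸ hjk.symm, Or.inr (Or.inr h)⟩
  have e3 : ({i, j, k} : Finset κ).erase k = {i, j} := by
    ext x; simp only [Finset.mem_erase, Finset.mem_insert, Finset.mem_singleton]
    constructor
    · rintro ⟨hx, h | h | h⟩
      · exact Or.inl h
      · exact Or.inr h
      · exact absurd h hx
    · rintro (h | h)
      · exact ⟨h ▸ hik, Or.inl h⟩
      · exact ⟨h ▸ hjk, Or.inr (Or.inl h)⟩
  rw [e1, e2, e3, rsubperm_pair M h₁₂ hjk, rsubperm_pair M h₁₂ hik, rsubperm_pair M h₁₂ hij]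
  ring

/-- Square-matrix form (`Matrix.subperm`) of `rsubperm_triple`. [cite: BurgisserClausenShokrollahi1997, (21.30)] -/
theorem subperm_triple {ι : Type*} [Fintype ι] [DecidableEq ι] (M : Matrix ι ι R) {r₀ r₁ r₂ : ι}
    {i j k : ι} (h₀₁ : r₀ ≠ r₁) (h₀₂ : r₀ ≠ r₂) (h₁₂ : r₁ ≠ r₂) (hij : i ≠ j) (hik : i ≠ k)
    (hjk : j ≠ k) :
    M.subperm (· ∈ ({i, j, k} : Finset ι)) (· ∈ ({r₀, r₁, r₂} : Finset ι)) =
      M r₀ i * (M r₁ j * M r₂ k + M r₁ k * M r₂ j) +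
        M r₀ j * (M r₁ i * M r₂ k + M r₁ k * M r₂ i) +
        M r₀ k * (M r₁ i * M r₂ j + M r₁ j * M r₂ i) := by
  rw [← rsubperm_eq_subperm]
  exact rsubperm_triple M h₀₁ h₀₂ h₁₂ hij hik hjk

end Triple

end AlperBogartVelasco

end Literature.Computability.AlgebraicComplexity

end
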